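import Summits.QuantumFields.YangMills.Theorems.ParabolicTrajectoryLatticeGapOnTrajectorySparseDefectDefs
import Summits.QuantumFields.YangMills.Theorems.ParabolicTrajectoryLatticeGapOnTrajectoryStubDecayOfTypicalWindows
import Summits.QuantumFields.YangMills.Theorems.ParabolicTrajectoryLatticeGapOnTrajectoryStubGapOfDecay
import Summits.QuantumFields.YangMills.Theorems.ParabolicTrajectoryLatticeGapOnTrajectoryStubSlabClusteringOfDecay
import Summits.QuantumFields.YangMills.Theorems.ParabolicTrajectoryLatticeGapOnTrajectorySparseDefectEngineSanity

/-!
# Line `sparse-defect-orbit-window` (served slug `SketchIdeator5-r2`) — skeleton for crux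
`ParabolicTrajectory.LatticeGapOnTrajectory` (stmt-QuantumFields-10523, conjunct (B) of route ParabolicTrajectory),
crux-ideate round 2 k5, lead c4 (prover-line-stmt-QuantumFields-10523-c4-0), 2026-08-16.

**Idea (Cruxes/LatticeGapOnTrajectory/Ideas/sparse-defect-orbit-window.md).** Wilson's torus state only ever shows
ν-typical shell data, so the Dobrushin–Shlosman/Kantorovich comparison of the okfs line may give rare anomalous
windows a free pass: demand the orbit–Kantorovich contraction only for shell data in a product GOOD set, bound every
other datum by a crude total-variation Lipschitz constant `A_k = poly(D_k)`, and let hereditary joint `ε_k`-sparseness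
of bad cells with `ε_k (1 + A_k) → 0` pay for the free passes (ANNEALED sparse-defect engine, the line's open G-blind
stub). Everything downstream of the engine is ENGINE-INDEPENDENT: Sub₁ (`Split.LatticeGapOnTrajectoryLat`) is reached
through the typed interface `CellDecayAlongP` (cell-scale covariance decay for orbit-Lipschitz observables + rough-centre
bound + polynomial resolution clause; Defs `…SparseDefectDefs.lean`), by the two landed okfs deployments re-plumbed at
their single engine call sites (`stub_gapOfDecay` ← p95642, `stub_slabClusteringOfDecay` ← p123095); the filed decl is
reached through the landed glue of the split (p124272) with the two certified residuals (α `stub_symmetrise`,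
β `stub_volume`, shared verbatim with the okfs and step-scaling skeletons; NOT claimed).

Stubs (registered by `stub-add`, not `skeleton check`, so as not to archive the concurrent lead a3's registration of
`StepScalingSketch` — the item's skeleton slot is single): `stub_typicalOrbitWindow` (THE PHYSICS, open),
`stub_sparseDefectEngine` (annealed engine, lead's stub, open — crux-sized, see Cruxes/…/Lines/SketchIdeator5-r2.md §Engine;
sanity `kREngine_of_sparseDefectEngine` p128070: it implies the landed sup-form engine), LANDED after wave 1:
`stub_decayOfTypicalWindows` (p127716), `stub_gapOfDecay` (p127898), `stub_slabClusteringOfDecay` (p128168, helper p127993); `stub_volume`, `stub_symmetrise`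
(residuals, registered by a3 with the SAME short signatures `Split.VolumeGrowthOnTrajectory` / `Split.SymmetrisationOnTrajectory`). Composition (no hypotheses, concludes the crux BY NAME, sorry only inside the stubs it calls):
`LatticeGapOnTrajectory_of`.

Disproof.lean (v4.3, RESISTS) used: §2 `concl_iff_split` (independent rates, glued by `min`); §3
`tunedWitnessExists_of_not_crux` (no stub here is Lean-refutable without a tuned witness; the engine stub IS refutable by
finite toys — it quantifies over all finite specifications — and that is where the disprover should aim); §4b/4c zero
coupling (`hasLatticeMassGap_of_zero_coupling`, `uniformSlabClustering_of_zero_coupling` p121622): at `β = 0` the typical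
package holds with all data good and the engine degenerates to the landed `KREngine` — the currency is not
junk-contradictory; §5 `WithoutSimple` honoured at `stub_typicalOrbitWindow` only (typical data of `U(1)` transmit the
constant-curvature mode, drefute gen-2 §3(c)); §6(i)(ii) respected (`Δ = κ/(4t(θ))`, constants per pair);
`Negative/TransferObstruction` and the volume analysis concern the residuals only.
-/

set_option autoImplicit false

noncomputable section

namespace Summit.QuantumFields.YangMills.Cruxes.LatticeGapOnTrajectory.SparseDefectOrbitWindow

open scoped BigOperators Topology ENNReal ProbabilityTheory
open Filter MeasureTheory
open Literature.Probability.LatticeModels (Specification IsSpecification IsGibbsMeasure glueWith)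
open Literature.MathematicalPhysics.QuantumFieldTheory
open Summit.QuantumFields.YangMills.Theses.ParabolicTrajectory
open Summit.QuantumFields.YangMills.Cruxes.LatticeGapOnTrajectory.OrbitKantorovichFiniteSize

/-! ## §1 The physics and the engine (open) -/

/-- **stub_typicalOrbitWindow** — THE PHYSICS (open; the line's bet; weaker than the registered okfs physics stub
`stub_orbitKantorovichWindow` in its contraction clause, stronger in asking hereditary sparseness). Along every tuned
`M`-adic weak-coupling Wilson scheme of a compact simple `G` there are a cell scale `t`, a radius `n₀`, a ratio
`γ₀ < 1`, a resolution `α_k > 0` with the polynomial clause, crude constants `A_k ≥ 0` and sparseness levels `ε_k ≥ 0`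
with `ε_k (1 + A_k) → 0`, and rough-centre constants `K_s`, such that eventually in `k`, on every torus `S ≥ L_k` and
every frame family of scale `t·M^{n_k}`, Wilson's torus specification at `β_k` carries the TYPICAL orbit–Kantorovich
package for some good cell events and some profile (`IsTypicalKRWindow`), bad cells are hereditarily jointly
`ε_k`-sparse under the window kernels given good shells and jointly `ε_k`-sparse under Wilson's torus measure, and the
rough-centre bound holds. Intended instance (card): `good y = {at most q_k plaquettes of cell y are ε₀-large}`,
`α_k = λ/β_k`, `A_k ≍ λ·#straddling plaquettes`, `q_k + 1 ≥ max(2e·mean count, K log₂ D_k)`. The only stub using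
`IsCompactSimpleLieGroup`, `β_k → ∞` and the tuning. -/
theorem stub_typicalOrbitWindow :
    ∀ (G : Type) [Group G] [TopologicalSpace G] [IsTopologicalGroup G] [CompactSpace G]
      [MeasurableSpace G] [BorelSpace G], IsCompactSimpleLieGroup G →
      ∀ (r : LatticeRep G) (M : ℕ) (θ : ℝ) (sch : SpeciesScheme (YMSpecies G)) (n : ℕ → ℕ),
        2 ≤ M → 0 < θ → (∀ k, sch.a k = ((M : ℝ) ^ n k)⁻¹) → Tendsto sch.β atTop atTop →
        Tendsto (fun k => ((M : ℝ) ^ n k) ^ 8 *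
            latticeConnectedCorr r.ρ (sch.β k) (sch.side k) r.curvature.F r.curvature.F (M ^ n k))
          atTop (𝓝 θ) →
        TypicalOrbitWindowsAlongP r M sch n := by
  sorry

/-- **stub_sparseDefectEngine** — THE ANNEALED SPARSE-DEFECT ENGINE (open; G-blind finite probability; the lead's
stub). Dobrushin–Shlosman/Kantorovich covariance decay when the contraction is known only for good shell data, with a
crude constant `A` elsewhere, under hereditary joint `ε`-sparseness of bad cells and the smallness `ε(1+A) ≤ c₀`.
Quenched model: von Dreifus–Klein–Perez, CMP 170 (1995) 21. Annealed statement: not in print (card falsifier (1)). -/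
theorem stub_sparseDefectEngine : SparseDefectEngine := by
  sorry

/-! ## §2 Plumbing: the typical package feeds the decay interface -/

/-! `stub_decayOfTypicalWindows` (plumbing): LANDED p127716 — `Theorems/ParabolicTrajectoryLatticeGapOnTrajectoryStubDecayOfTypicalWindows.lean` (imported; the composition uses the landed theorem by name). -/

/-! ## §3 The two deployments, re-plumbed through the decay interface (forks of p95642 / p123095) -/

/-! `stub_gapOfDecay` (fork of p95642 through the decay interface): LANDED p127898 — `Theorems/ParabolicTrajectoryLatticeGapOnTrajectoryStubGapOfDecay.lean` (imported; helpers `abs_corr_le_far_of_decay`, `abs_latticeConnectedCorr_le_of_decay`). -/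

/-! `stub_slabClusteringOfDecay` (fork of p123095 through the decay interface): LANDED p128168 — `Theorems/ParabolicTrajectoryLatticeGapOnTrajectoryStubSlabClusteringOfDecay.lean` (helper `…SlabClusteringOfDecayFar.lean` p127993; imported). -/

/-! ## §4 The two certified residuals of the FILED crux (shared verbatim with the okfs / step-scaling skeletons; NOT claimed) -/

/-- **stub_volume** — RESIDUAL (β) = Sub₂ of the landed split, NOT CLAIMED PROVABLE (registered with this signature by lead a3; shared): the crux hypotheses do
not mention the torus half-sides `L_k` beyond `a_k L_k → ∞`, yet every transfer on the scheme's own tori needs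
`a_k L_k / log(1/a_k) → ∞`; the planner's restatement adds this clause to (B) and the stub disappears. -/
theorem stub_volume : Split.VolumeGrowthOnTrajectory := by
  sorry

/-- **stub_symmetrise** — RESIDUAL (α) = Sub₃ of the landed split, NOT CLAIMED PROVABLE (registered with this signature by lead a3; shared): from the transfer
clause for reflection-symmetric polynomially bounded witnesses at some rate to the filed clause over ALL `sch'`
(Müntz obstruction, `Negative/TransferObstruction.lean`); the planner's restatement deletes it. -/
theorem stub_symmetrise : Split.SymmetrisationOnTrajectory := by
  sorry

/-! ## §5 The composition (kernel-checked; `sorry` only inside the stubs it invokes) -/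

/-- **Sub₁ from the line** (`Split.LatticeGapOnTrajectoryLat`): physics → typical package → (engine, plumbing) decay
package → the two re-plumbed deployments at independent rates, glued at the minimum. -/
theorem latticeGapOnTrajectoryLat_of_line : Split.LatticeGapOnTrajectoryLat := by
  intro G _ _ _ _ _ _ hG r M θ sch n hM hθ hshape hβ htune
  have hT := stub_typicalOrbitWindow G hG r M θ sch n hM hθ hshape hβ htune
  have hD : CellDecayAlongP r M sch n :=
    stub_decayOfTypicalWindows G r M sch n stub_sparseDefectEngine (stub_wilsonTorusDLR G r) hT
  obtain ⟨Δ₁, hΔ₁, hlat⟩ :=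
    stub_gapOfDecay G r M sch n hM hshape stub_torusFrames stub_specificationTower (stub_wilsonTorusDLR G r) hD
  obtain ⟨Δ₂, hΔ₂, hclust⟩ :=
    stub_slabClusteringOfDecay G r M sch n hM hshape stub_torusFrames stub_specificationTower
      (stub_wilsonTorusDLR G r) hD
  exact ⟨min Δ₁ Δ₂, lt_min hΔ₁ hΔ₂, Split.hasLatticeMassGap_of_le r sch (min_le_left _ _) hlat,
    Split.uniformSlabClustering_of_le r sch (min_le_right _ _) hclust⟩

/-- **The line closes the crux** (concludes `ParabolicTrajectory.LatticeGapOnTrajectory` BY NAME, no hypotheses;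
`sorry` only inside the stubs it invokes): Sub₁ from the line, the volume residual as Sub₂, the symmetrisation
residual as Sub₃, glued by the landed `Split.latticeGapOnTrajectory_of_subs` (p124272). -/
theorem LatticeGapOnTrajectory_of : LatticeGapOnTrajectory :=
  Split.latticeGapOnTrajectory_of_subs latticeGapOnTrajectoryLat_of_line stub_volume stub_symmetrise

end Summit.QuantumFields.YangMills.Cruxes.LatticeGapOnTrajectory.SparseDefectOrbitWindow

end
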